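import Literature.AlgebraicGeometry.HodgeTheory.ComplexOrientationFamily
import Literature.AlgebraicGeometry.HodgeTheory.RationalLatticeIntegral
import Literature.AlgebraicGeometry.HodgeTheory.TopDegreeClasses
import Literature.AlgebraicTopology.SingularHomology.FundamentalClassExistence
import Literature.AlgebraicTopology.SingularHomology.UniversalCoefficientsFree
import Literature.AlgebraicTopology.SingularHomology.HomologySpheresProofs
import Literature.AlgebraicTopology.SingularHomology.ProductKunnethField
import Literature.AlgebraicTopology.SingularHomology.CohomologyOfPoint
import HarnessLib

/-!
# The integral (co)homology of a smooth projective complex curve is free; a graded `ℤ`-basis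

For `C` a smooth projective curve over `ℂ`, `C(ℂ)` is a closed connected oriented surface, so its
integral homology and cohomology are finitely generated FREE in every degree and vanish above
degree `2` (Griffiths–Harris Ch. 2 §1 / Hatcher §3.3: `H₀ ≅ ℤ`, `H₂ ≅ ℤ` by orientation — Thm. 3.26;
`H₁ ≅ H¹` by Poincaré duality — Thm. 3.30 — and `H¹ = Hom(H₁, ℤ) ⊕ Ext(H₀, ℤ)` is torsion-free
— Thm. 3.2, Cor. 3.3; no triangulation or classification of surfaces is used). Consequently
`H*(C(ℂ); ℤ)` admits a GRADED BASIS IN THE LERAY–HIRSCH SENSE (Hatcher Thm. 3.16 hypothesis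
"`Hᵏ(Y; R)` finitely generated free for all `k`"): the fibre input of the tree's integral Künneth
theorem for `(Y ⊗ C)(ℂ)` (`HodgeTheory.singularCohomology_lhMap_bijective_tensor`,
`exists_eq_sum_cross_tensor`, `exists_restrictToCompl_eq_nsmul_of_gradedBasis` of
`HodgeTheory/CrossProductsGenericDivisibility`).

* `free_singularHomology_int_complexPoints_curve` — `Hₖ(C(ℂ); ℤ)` is free for every `k`;
* `free_singularCohomology_int_complexPoints_curve`, `finite_singularCohomology_int_complexPoints_curve`,
  `subsingleton_singularCohomology_int_complexPoints_curve_of_lt` — `Hᵏ(C(ℂ); ℤ)` is free,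
  finitely generated, and `0` for `k > 2`;
* `exists_gradedBasis_int_complexPoints_curve` — a graded `ℤ`-basis of `H*(C(ℂ); ℤ)` in the
  Leray–Hirsch sense (degrees `≤ 2`).

All inputs are PROVED tree theorems: the complex orientation `complexOrientationInt`, Poincaré
duality `poincare_duality`, `Hₙ ≅ R` (`nonempty_singularHomology_top_iso_holds`), universal
coefficients (`kroneckerPairing_bijective_of_free`, `torsion_singularCohomology_eq_bot_of_free`),
finiteness (`finite_singularHomology_int_complexPoints`), connectedness
(`connectedSpace_complexPoints`). Everything is proved; no definitions, no named facts.

## References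

* A. Hatcher, *Algebraic Topology* (2002), §3.1 Thm. 3.2, Cor. 3.3; §3.2 Thm. 3.16; §3.3
  Thm. 3.26, Thm. 3.30. [HatcherAT2002]
* P. Griffiths, J. Harris, *Principles of Algebraic Geometry* (1978), Ch. 0 §4, Ch. 2 §1.
  [GriffithsHarris1978]
-/

noncomputable section

open Function CategoryTheory Literature.AlgebraicGeometry.Motives
  Literature.AlgebraicTopology.SingularHomology
  Literature.AlgebraicTopology.SingularHomology.LerayHirsch

namespace Literature.AlgebraicGeometry.HodgeTheory

variable {C : SchemeOver ℂ}

/-- The coordinate map of a finite basis is bijective (`r ↦ Σ rᵢ bᵢ` is `b.equivFun.symm`).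
[folklore] -/
theorem bijective_sum_smul_of_basis (R : Type) [CommRing R] {M : Type} [AddCommGroup M]
    [Module R M] {ι : Type} [Fintype ι] (b : Module.Basis ι R M) :
    Bijective fun r : ι → R ↦ ∑ i, r i • b i := by
  have : (fun r : ι → R ↦ ∑ i, r i • b i) = b.equivFun.symm :=
    funext fun r ↦ (b.equivFun_symm_apply r).symm
  rw [this]
  exact b.equivFun.symm.bijective

/-- `X(ℂ)` is path connected for `X` smooth projective (connected, and locally path connected as a
manifold) — a private copy of the tree's `pathConnectedSpace_complexPoints_of_isSmoothProjective`
(`HolomorphicBundleChernCharacterTopDegree`, behind the Kähler imports), kept out of this import cone.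
[cite: HatcherAT2002, §3.3 p. 233] -/
private theorem pathConnectedSpace_complexPoints' {n : ℕ} {X : SchemeOver ℂ}
    (hX : IsSmoothProjective n X) : PathConnectedSpace (ComplexPoints X) := by
  letI := hX.chartedSpace
  haveI : ConnectedSpace (ComplexPoints X) := connectedSpace_complexPoints hX
  haveI : LocallyPathConnectedSpace (ComplexPoints X) :=
    ChartedSpace.locallyPathConnectedSpace (H := EuclideanSpace ℝ (Fin (2 * n)))
      (M := ComplexPoints X)
  exact pathConnectedSpace_iff_connectedSpace.2 inferInstance

/-- **`H¹(C(ℂ); ℤ)` is finitely generated and free** for a smooth projective complex curve `C`: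
`H¹ ≅ H₁` (Poincaré duality) is finitely generated, and `H¹` is torsion-free (universal
coefficients, `H₀ ≅ ℤ` free). [cite: HatcherAT2002, §3.3 Thm. 3.30 and §3.1 Cor. 3.3] -/
theorem free_and_finite_singularCohomology_one_int_curve (hC : IsSmoothProjective 1 C) :
    Module.Free ℤ (singularCohomology ℤ ℤ (ComplexPoints C) 1) ∧
      Module.Finite ℤ (singularCohomology ℤ ℤ (ComplexPoints C) 1) := by
  letI := hC.chartedSpace
  haveI := ComplexPoints.compactSpace_of_isSmoothProjective hC
  haveI := ComplexPoints.t2Space_of_isSmoothProjective hC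
  haveI := pathConnectedSpace_complexPoints' hC
  -- `H¹ ≅ H₁`, finitely generated
  let e : singularCohomology ℤ ℤ (ComplexPoints C) 1 ≃ₗ[ℤ] singularHomology ℤ ℤ (ComplexPoints C) 1 :=
    poincareDualityEquiv (complexOrientationInt hC) (show 1 + 1 = 2 * 1 by rfl)
      (poincare_duality (complexOrientationInt hC) _)
  haveI := finite_singularHomology_int_complexPoints hC 1
  haveI hfin : Module.Finite ℤ (singularCohomology ℤ ℤ (ComplexPoints C) 1) :=
    Module.Finite.equiv e.symm
  -- `H¹` is torsion-free
  haveI : Module.Free ℤ (singularHomology ℤ ℤ (ComplexPoints C) 0) := free_singularHomology_zero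
  have htor : Submodule.torsion ℤ (singularCohomology ℤ ℤ (ComplexPoints C) 1) = ⊥ :=
    torsion_singularCohomology_eq_bot_of_free ℤ (ComplexPoints C) 0
  haveI : Module.IsTorsionFree ℤ (singularCohomology ℤ ℤ (ComplexPoints C) 1) :=
    Submodule.isTorsionFree_iff_torsion_eq_bot.2 htor
  exact ⟨Module.free_of_finite_type_torsion_free', hfin⟩

/-- **`Hₖ(C(ℂ); ℤ)` is free for every `k`**, `C` a smooth projective complex curve: `H₀ ≅ ℤ`
(path connected), `H₁ ≅ H¹` free, `H₂ ≅ ℤ` (orientation), `Hₖ = 0` for `k ≥ 3`.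
[cite: HatcherAT2002, §3.3 Thm. 3.26 and Thm. 3.30] [cite: GriffithsHarris1978, Ch. 2 §1] -/
theorem free_singularHomology_int_complexPoints_curve (hC : IsSmoothProjective 1 C) (k : ℕ) :
    Module.Free ℤ (singularHomology ℤ ℤ (ComplexPoints C) k) := by
  letI := hC.chartedSpace
  haveI := ComplexPoints.compactSpace_of_isSmoothProjective hC
  haveI := ComplexPoints.t2Space_of_isSmoothProjective hC
  haveI := pathConnectedSpace_complexPoints' hC
  haveI : ConnectedSpace (ComplexPoints C) := connectedSpace_complexPoints hC
  rcases Nat.lt_or_ge k 3 with hk | hk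
  · interval_cases k
    · exact free_singularHomology_zero
    · -- `H₁ ≅ H¹`, free
      let e : singularCohomology ℤ ℤ (ComplexPoints C) 1 ≃ₗ[ℤ]
          singularHomology ℤ ℤ (ComplexPoints C) 1 :=
        poincareDualityEquiv (complexOrientationInt hC) (show 1 + 1 = 2 * 1 by rfl)
          (poincare_duality (complexOrientationInt hC) _)
      haveI := (free_and_finite_singularCohomology_one_int_curve hC).1
      exact Module.Free.of_equiv e
    · -- `H₂ ≅ ℤ`
      obtain ⟨i⟩ := nonempty_singularHomology_top_iso_holds (R := ℤ) (X := ComplexPoints C) (2 * 1)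
        (complexOrientationInt hC)
      exact Module.Free.of_equiv i.toLinearEquiv.symm
  · haveI : Subsingleton (singularHomology ℤ ℤ (ComplexPoints C) k) :=
      ModuleCat.subsingleton_of_isZero (ComplexPoints.isZero_singularHomology_of_lt hC ℤ ℤ (by omega))
    exact Module.Free.of_subsingleton ℤ _

/-- **`Hᵏ(C(ℂ); ℤ)` is free and finitely generated for every `k`**, `C` a smooth projective complex
curve: `H⁰ ≅ ℤ`; `H¹` above; `Hᵏ⁺¹ ≅ Hom(Hₖ₊₁, ℤ)` for `k ≥ 1` (universal coefficients, all `Hₖ`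
free), a dual of a finitely generated free module. [cite: HatcherAT2002, §3.1 Thm. 3.2]
[cite: GriffithsHarris1978, Ch. 2 §1] -/
theorem free_and_finite_singularCohomology_int_complexPoints_curve (hC : IsSmoothProjective 1 C)
    (k : ℕ) :
    Module.Free ℤ (singularCohomology ℤ ℤ (ComplexPoints C) k) ∧
      Module.Finite ℤ (singularCohomology ℤ ℤ (ComplexPoints C) k) := by
  haveI := pathConnectedSpace_complexPoints' hC
  rcases k with _ | k
  · -- `H⁰ ≅ ℤ`
    let e := singularCohomologyZeroEquiv ℤ ℤ (ComplexPoints C)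
    exact ⟨Module.Free.of_equiv e.symm, Module.Finite.equiv e.symm⟩
  rcases k with _ | k
  · exact free_and_finite_singularCohomology_one_int_curve hC
  · -- `Hᵏ⁺² ≅ Hom(Hₖ₊₂, ℤ)`, `Hₖ₊₁` free
    haveI := free_singularHomology_int_complexPoints_curve hC (k + 1)
    haveI := free_singularHomology_int_complexPoints_curve hC (k + 2)
    haveI := finite_singularHomology_int_complexPoints hC (k + 2)
    let e := LinearEquiv.ofBijective _
      (kroneckerPairing_bijective_of_free ℤ (ComplexPoints C) (k + 1))
    exact ⟨Module.Free.of_equiv e.symm, Module.Finite.equiv e.symm⟩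

/-- `Hᵏ(C(ℂ); ℤ)` is free, `C` a smooth projective complex curve. [cite: HatcherAT2002, §3.1 Thm. 3.2] -/
theorem free_singularCohomology_int_complexPoints_curve (hC : IsSmoothProjective 1 C) (k : ℕ) :
    Module.Free ℤ (singularCohomology ℤ ℤ (ComplexPoints C) k) :=
  (free_and_finite_singularCohomology_int_complexPoints_curve hC k).1

/-- `Hᵏ(C(ℂ); ℤ)` is finitely generated, `C` a smooth projective complex curve.
[cite: HatcherAT2002, §3.1 Thm. 3.2 and App. A Cor. A.9] -/
theorem finite_singularCohomology_int_complexPoints_curve (hC : IsSmoothProjective 1 C) (k : ℕ) :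
    Module.Finite ℤ (singularCohomology ℤ ℤ (ComplexPoints C) k) :=
  (free_and_finite_singularCohomology_int_complexPoints_curve hC k).2

/-- **`Hᵏ(C(ℂ); ℤ) = 0` for `k > 2`**, `C` a smooth projective complex curve (`Hᵏ ≅ Hom(Hₖ, ℤ)`,
`Hₖ = 0` above the dimension, `Hₖ₋₁` free). [cite: HatcherAT2002, §3.1 Thm. 3.2 and §3.3 Thm. 3.26] -/
theorem subsingleton_singularCohomology_int_complexPoints_curve_of_lt (hC : IsSmoothProjective 1 C)
    {k : ℕ} (hk : 2 < k) : Subsingleton (singularCohomology ℤ ℤ (ComplexPoints C) k) := by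
  obtain ⟨k, rfl⟩ : ∃ k', k = k' + 1 := ⟨k - 1, by omega⟩
  haveI := free_singularHomology_int_complexPoints_curve hC k
  haveI : Subsingleton (singularHomology ℤ ℤ (ComplexPoints C) (k + 1)) :=
    ModuleCat.subsingleton_of_isZero (ComplexPoints.isZero_singularHomology_of_lt hC ℤ ℤ (by omega))
  exact (kroneckerPairing_bijective_of_free ℤ (ComplexPoints C) k).1.subsingleton

/-- **A graded `ℤ`-basis of `H*(C(ℂ); ℤ)` in the Leray–Hirsch sense**, `C` a smooth projective
complex curve: bases `v k i` of the free finitely generated `Hᵏ(C(ℂ); ℤ)`, `k ≤ 2`, and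
`Hᵏ = 0` for `k > 2`, so that over the one-point base the comparison map
`(aⱼ) ↦ Σⱼ aⱼ ⌣ vⱼ : Π_{d j ≤ k} H^{k - d j}(pt; ℤ) → Hᵏ(C(ℂ); ℤ)` is bijective for every `k`
(`LerayHirsch.bijective_lhMap_const_of_basis`) — the hypothesis on the fibre of the integral
Künneth theorem for `(Y ⊗ C)(ℂ)` (Hatcher Thm. 3.16). [cite: HatcherAT2002, §3.2 Thm. 3.16]
[cite: GriffithsHarris1978, Ch. 2 §1] -/
theorem exists_gradedBasis_int_complexPoints_curve (hC : IsSmoothProjective 1 C) :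
    ∃ (σ : Fin (2 + 1) → Type) (_ : ∀ k, Fintype (σ k))
      (v : (k : Fin (2 + 1)) → σ k → singularCohomology ℤ ℤ (ComplexPoints C) k),
      ∀ k, Bijective (lhMap ℤ (fun j : (Σ k, σ k) ↦ (j.1 : ℕ))
        (ContinuousMap.const (ComplexPoints C) PUnit.unit : C(ComplexPoints C, PUnit.{1}))
        (fun j ↦ v j.1 j.2) k) := by
  classical
  haveI := fun k : Fin (2 + 1) ↦ free_singularCohomology_int_complexPoints_curve hC k
  haveI := fun k : Fin (2 + 1) ↦ finite_singularCohomology_int_complexPoints_curve hC k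
  let σ : Fin (2 + 1) → Type := fun k ↦
    Module.Free.ChooseBasisIndex ℤ (singularCohomology ℤ ℤ (ComplexPoints C) k)
  let b : (k : Fin (2 + 1)) → Module.Basis (σ k) ℤ (singularCohomology ℤ ℤ (ComplexPoints C) k) :=
    fun k ↦ Module.Free.chooseBasis ℤ _
  haveI : ∀ k, Fintype (σ k) := fun k ↦ inferInstance
  refine ⟨σ, inferInstance, fun k i ↦ b k i, ?_⟩
  exact bijective_lhMap_const_of_basis ℤ (fun k i ↦ b k i)
    (fun k ↦ bijective_sum_smul_of_basis ℤ (b k))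
    (fun k hk ↦ subsingleton_singularCohomology_int_complexPoints_curve_of_lt hC hk)

end Literature.AlgebraicGeometry.HodgeTheory

end
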